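import Literature.NumberTheory.Transcendental.KZProductIdeal
import Literature.NumberTheory.Transcendental.KZCalculusProofs
import HarnessLib

/-!
# `LinearDescent`, `FixedDimMerge`, `AddClosed` — statements only (definition lane)

Definitions split off `RootDecompQuadraticDescentMerge.lean` (cell decomp-kz, lens 6, gen 4) so that the
proof file can land in the proof lane: the singles slice `LinearDescent d` of the crux
`RootDecompQuadraticDescent.QuadraticDescent` (stmt-26540), the separating merge lemma `FixedDimMerge d`,
the arithmetic statement `AddClosed d`, and the per-level copy `QuadraticDescentAt d` of the crux.
[Kontsevich–Zagier 2001, §1.1–1.2] -/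

noncomputable section

set_option linter.dupNamespace false

namespace Summit.KontsevichZagierPeriods.KontsevichZagierPeriods.Theorems.RootDecompQuadraticDescentMerge

open Literature.NumberTheory.Transcendental
open Literature.NumberTheory.Transcendental.KZ

/-! ### The statements -/

/-- `Coinc R d`: `R` contains the difference of every pair of equal-valued KZ-rational representations of
dimensions `≤ d` (the hypothesis `hC` of the route's pieces). -/
def Coinc (R : AddSubgroup KZ.FormalRep) (d : ℕ) : Prop :=
  ∀ ⦃n m : ℕ⦄, n ≤ d → m ≤ d → ∀ (r : KZ.IntegralRep n) (r' : KZ.IntegralRep m),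
    r.IsRational → r'.IsRational → r.value = r'.value → KZ.of r - KZ.of r' ∈ R

/-- The KZ-rational SINGLES of dimension `≤ d` (second generator family of `QuadraticDescent d`). -/
def singles (d : ℕ) : Set KZ.FormalRep :=
  {y | ∃ (k : ℕ) (u : KZ.IntegralRep k), k ≤ d ∧ u.IsRational ∧ y = KZ.of u}

/-- The top PRODUCTS of `QuadraticDescent d` (first generator family). -/
def products (d : ℕ) : Set KZ.FormalRep :=
  {y | ∃ (a b : ℕ) (s : KZ.IntegralRep a) (t : KZ.IntegralRep b),
    a ≤ d ∧ b ≤ d ∧ a + b ≤ d + 1 ∧ s.IsRational ∧ t.IsRational ∧ y = KZ.of s * KZ.of t}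

/-- **LinearDescent(d)** — the singles slice of `QuadraticDescent d`: pair form in dimensions `≤ d`
implies kernel form among KZ-rational representations of dimensions `≤ d`, relative to every
multiplicatively closed subgroup `R ⊇ KZ.relations`. Implied by the summit (`linearDescent_of_summit`);
NOT known to follow from `Coinc R d` alone. -/
def LinearDescent (d : ℕ) : Prop :=
  ∀ R : AddSubgroup KZ.FormalRep, KZ.relations ≤ R →
    (∀ c ∈ R, ∀ y : KZ.FormalRep, c * y ∈ R ∧ y * c ∈ R) → Coinc R d →
    ∀ x : KZ.FormalRep, x ∈ AddSubgroup.closure (singles d) → KZ.eval x = 0 → x ∈ R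

/-- **FixedDimMerge(d)** — two KZ-rational representations of dimensions `≤ d` merge INSIDE dimension
`≤ d` by the moves. Equivalent, given the summit, to `AddClosed d`; not implied by the summit alone. -/
def FixedDimMerge (d : ℕ) : Prop :=
  ∀ ⦃a b : ℕ⦄, a ≤ d → b ≤ d → ∀ (u : KZ.IntegralRep a) (u' : KZ.IntegralRep b),
    u.IsRational → u'.IsRational →
      ∃ (k : ℕ) (G : KZ.IntegralRep k), k ≤ d ∧ G.IsRational ∧ KZ.of u + KZ.of u' - KZ.of G ∈ KZ.relations

/-- **AddClosed(d)** — the values of KZ-rational representations of dimension `≤ d` form an additively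
closed set (an arithmetic statement: no universal integrand exists in fixed dimension with
`ℚ`-coefficients, so sums are realised only by arranging endpoints / polynomial parts). -/
def AddClosed (d : ℕ) : Prop :=
  ∀ ⦃a b : ℕ⦄, a ≤ d → b ≤ d → ∀ (u : KZ.IntegralRep a) (u' : KZ.IntegralRep b),
    u.IsRational → u'.IsRational →
      ∃ (k : ℕ) (G : KZ.IntegralRep k), k ≤ d ∧ G.IsRational ∧ G.value = u.value + u'.value

/-- The route's crux `QuadraticDescent` AT LEVEL `d` (text of
`Summit.KontsevichZagierPeriods.KontsevichZagierPeriods.Theses.RootDecompQuadraticDescent.QuadraticDescent`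
with the leading `∀ d, 2 ≤ d →` removed; `QuadraticDescent ↔ ∀ d, 2 ≤ d → QuadraticDescentAt d` is `Iff.rfl`
up to unfolding `products ∪ singles`). -/
def QuadraticDescentAt (d : ℕ) : Prop :=
  ∀ R : AddSubgroup KZ.FormalRep, KZ.relations ≤ R →
    (∀ c ∈ R, ∀ y : KZ.FormalRep, c * y ∈ R ∧ y * c ∈ R) → Coinc R d →
    ∀ x : KZ.FormalRep, x ∈ AddSubgroup.closure (products d ∪ singles d) → KZ.eval x = 0 → x ∈ R

end Summit.KontsevichZagierPeriods.KontsevichZagierPeriods.Theorems.RootDecompQuadraticDescentMerge
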